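import Literature.MathematicalPhysics.QuantumFieldTheory.Balaban1983to89.B8Prop6CubeMemberBdryBeta
import Literature.MathematicalPhysics.QuantumFieldTheory.Balaban1983to89.B8Prop6CubeMemberGaugedBdry

/-!
# `Balaban1983to89.B8Prop6CubeMemberGaugedBdryBeta` — [Balaban1985RegularSpaces] PROPOSITION 6 (p. 99) AT EVERY CUBE OF (1.131) FROM THEOREM 4 AS PRINTED
# ON THE CUBE SUB-FAMILY AND THE FOUR-LINE COLLAR SOCKET IN EDITION β (averaging datum over `Λb ∪ {level-0 crossing bonds}`, collar over the outer sides)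

statement-level skeleton of published theorems with citation tags; proofs where landed; nothing here is a claim about the
Yang–Mills mass gap

PDF held: `paper:balaban1985-cmp99-regular-spaces-gauge-fixing`; pp. 77, 81–83, 86–88, 98–99.

CITATION HEADER (lean-in-tree rule).  Cell `pub-ymgap` (D-0062), node N05 = [B8], seat `pub-ymgap-dag-n05-e` g8 (R141 (C) row s3b), 2026-08-27.  WHY:
dag-lead RULING №189 (2) (bus l.20717): the socket of record of the N06 → N05 cube-road junction is dag-n06-b's EDITION β `B9SupplySockB9P3ZdBeta.SockB9P3D4β`
(p541339, with the A6 witness of its member supplier's hypothesis set at truncation 0).  `B8Prop6CubeMemberBdryBeta` (this seat) re-runs the norm members of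
(1.136) from the β socket at the cube member.  THIS FILE re-runs p540540's two compositions on it: ★ `gaugedBoundB8_cubeMember_of_thm4_b9Dβ_d4`, ★
`prop6Printed_zdCub_of_thm4_b9Dβ_d4` — Proposition 6's knit letter on `zdCub ∘ f` from THEOREM 4 AS PRINTED on the cube sub-family (named hypothesis `H4`) and
the per-cube four-line β socket (its text = the body of `SockB9P3D4β` at the cube's data).  The `H4`-free form (Theorem 4's chain re-run in β) is this seat's
`B8Thm4KLevelBdryBeta` → `…ConcreteBdryBeta` → `…LeafModelZd3BdryBeta` → `B8LeafKnitZd3CubBdryBeta`.  Kind «kernel-checked proof», theorems only, no `def`.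

HONEST SCOPE.  (i) `H4` = Theorem 4 as printed on the cube sub-family is a HYPOTHESIS here; the per-cube β socket is a HYPOTHESIS ([4] Thm 3.3 for `G(1)`,
`H(1)` on the finite cube family WITH exterior data; dag-n06-b's member supplier serves it from `B9.Thm33Printed` + member-local binders, A6-witnessed at
truncation `m = 0` only — `B9SupplySockB9P3ZdBeta.Witness.sockB9P3D4β_at_nonvacuous_cube_zero`; levels `m ≥ 1` NOT witnessed), not discharged.  A6-PARTIAL (ref-E g10 READ-2∕3 on the R-d′ pair, bus l.21032∕l.21074, carried to β): at a
cube member the boundary pure-gauge mode `A′ = t·d𝟙_{□₀}` of p539131 is a datum of the socket with `J = 0`, `Φ₀ = 0` and `|B₁|β = ηt` (its crossing terms), so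
the β socket text is FALSE below an absolute threshold in `B₀` (line 1 needs `B₀ ≥ 1`; the gradient ∕ `∂*∂` ∕ `Δ` lines a larger absolute constant) — as in
print, where `B₀` is [4] Thm 3.3's constant; dag-n06-b's supplier delivers `B₀′ = max{1, 2B₀max{1,q}}`.  The theorems here hold for every `B₀ > 0`; below
that threshold their socket hypothesis is vacuous (partial vacuity, declared; no satisfiability claim of mine).  (ii)
`B_∂ ≥ 0`, `4B_∂ ≤ (dL − 1)B₀` are the tree's bookkeeping.  Count-neutral; N05 NOT discharged; one finite `𝕋⁴` programme at fixed `ε`, Bałaban as printed;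
nothing continuum ∕ ℝ⁴ ∕ OS ∕ mass-gap ∕ Clay.  No `sorry`, no `def`, no `instance`, no `notation`.  Unit `pub-ymgap-dag-n05-e` (g8), 2026-08-27.
-/

noncomputable section

open NormedSpace

namespace Literature.MathematicalPhysics.QuantumFieldTheory.Balaban1983to89.B8Prop6CubeMemberGaugedBdryBeta

open MatrixLog B7Prop1Explicit B7Prop2Explicit B7Prop1Local B7Eq92Concrete
open B7Prop3Flat (c3)
open B7Prop4GeneralLevels (logCovIter linCovIter)
open B8Ineq132 (InAk inAk_gaugeAct_iff pdevOn_lt_of_inAk covDerivFwd BondTouches)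
open B8Ineq133 (cutFixed)
open B8Eq115GaugeFixing (localGauge gaugeAct_mem_of)
open B8Eq119TwistedAxial (Restr129 InAx)
open B8Eq140Level (SideTouches)
open B8Eq146AExpansion (iEta plaqCovDeriv)
open B8Eq143PlaqExpansion (pdiv)
open B8Eq155JBound (Jcur wsup)
open B8ScaledSupNorm (bondNorm msup)
open B8Eq184Proof (cfgExp)
open B8Eq138LandauZd (IsLandau138W logCfg covLap)
open B8Eq131Cubes (tcube tLo tHi ctr tLo_le_tHi)
open B8Eq131CubesAdmissible (cubeFam)
open B8CubeMemberZd (cubeLamS cubeLamB hΩ_cubeFam hbox_cubeLamB hclass_cubeLamB htower_cubeLam hpart_cubeLam)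
open B8Prop6CubeMember (thm4_hypotheses_one_cutFixed)
open B8Lemma1NonAbelian (mulCfg)
open B8Prop6OfThm4 (const_136 smallness_134 localGauge_mem agree135)
open B8LeafModelZd (ZdIdx SockP5base SockP5 SockP5u)
open B8LeafModelZd3 (mlogCfg zdGF3)
open B8Prop6CubeMemberNormsAt (windows136_of_small)
open B8Prop6CubeMemberGauged (gaugedBoundB8_of_clauses)
open B8Prop3GaugeFixedKLevel (mem_unitaryUnits_of_mgauge_eq)
open B8Thm4AtLandau138 (mgauge_mgauge_inv)
open Node00 (CubeB8 GaugedBoundB8 zdCub prop6Printed_zdCub_iff)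

-- `Site` alone could resolve to the torus sites of `Setup.lean`; re-export the `ℤ^d` sites of `B7Prop1Explicit`.
export B7Prop1Explicit (Site)

variable {d : ℕ}

variable {𝔸 : Type} [CStarAlgebra 𝔸] [Nontrivial 𝔸]
open B8Prop6CubeMemberBdryBeta (norms136_cubeMember_at_bdryβ_d4)
open B9SupplySockB9P3ZdBeta (CrossB)

/-! ## §1 (1.135)–(1.138) at every cube from Theorem 4 as printed on the cube sub-family + the FOUR-LINE β socket at the cube -/

/-- ★ **PROPOSITION 6 (p. 99), (1.135)–(1.138) AS `Node00.GaugedBoundB8` AT EVERY CUBE, FROM THEOREM 4 AS PRINTED ON THE CUBE SUB-FAMILY AND THE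
FOUR-LINE COLLAR SOCKET IN EDITION β AT THE CUBE** — p540540's `gaugedBoundB8_cubeMember_of_thm4_b9DP_d4` with the socket binder in edition β (the body of
dag-n06-b's `SockB9P3D4β` at the cube: averaging datum `|B₁|β` over `Λb ∪ {level-0 crossing bonds of □₀}`, collar `Φ₀` over the outer sides); the norm members
come from `B8Prop6CubeMemberBdryBeta.norms136_cubeMember_at_bdryβ_d4`; everything else verbatim.
[cite: Balaban1985RegularSpaces, Prop. 6 (1.135)–(1.138) p.99, Thm 4 p.88, Prop. 3 p.87, (1.58)–(1.59) p.86, (1.29) p.81, (1.31) p.82] -/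
theorem gaugedBoundB8_cubeMember_of_thm4_b9Dβ_d4 (hd2 : 2 ≤ d) {L : ℕ} (hL : 2 ≤ L) (inp : B8.B9Inputs) {C₂ cB9 Bbd : ℝ}
    (hC₂ : 2097152 * ((d : ℝ) + 1) ^ 2 ≤ C₂) (hcB9 : 0 < cB9) (hBbd : 0 ≤ Bbd) (hBd : 4 * Bbd ≤ ((d : ℝ) * L - 1) * inp.B₀)
    (β : ℝ) (len : Site d → ℝ)
    (H4 : B8.Thm4Printed (5 * (d : ℝ) * L * inp.B₀)
      (fun i : {i : ZdIdx d L // ∃ (a : Site d) (M ρ : ℕ), L ≤ ρ ∧ ρ ≤ M ∧ 11 * d < M ∧ L ≤ d * M ∧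
        i.Ω = cubeFam false L a M ρ i.k ∧ i.Λs = cubeLamS L a M ρ i.k ∧ i.Λb = cubeLamB L a M ρ i.k} => (zdGF3 𝔸 L β len i.1).toGFData)) :
    ∃ c₁ : ℝ, 0 < c₁ ∧ ∀ (η : ℝ), 0 < η → ∀ {K : ℕ} {Ω : ℕ → Set (Site d)} (c : CubeB8 d L K Ω),
      -- the Prop.-3-frame b9 socket AT THE CUBE, EDITION β — FOUR LINES, |B₁|β over `Λb ∪ {level-0 crossing bonds}`, collar over the OUTER sides
      (∀ α₀ α₂ : ℝ, 0 < α₀ → α₀ ≤ cB9 → 0 < α₂ → α₂ ≤ cB9 →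
      ∀ (U₀ W : Site d → Fin d → 𝔸ˣ), (∀ x κ, U₀ x κ ∈ unitaryUnits 𝔸) → (∀ x κ, W x κ ∈ unitaryUnits 𝔸) →
      InAk L c.k η α₀ (cubeFam false L c.a c.M c.ρ c.k) U₀ → InAk L c.k η α₀ (cubeFam false L c.a c.M c.ρ c.k) (mulCfg W U₀) → IsLandau138W L c.k η ((cubeFam false L c.a c.M c.ρ c.k) 0) (cubeLamS L c.a c.M c.ρ c.k c.k) U₀ W →
      ∀ A' : Site d → Fin d → 𝔸, (∀ y τ, IsSelfAdjoint (A' y τ)) →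
      (∀ j, j ≤ c.k → ∀ (y : Site d) (τ : Fin d), SideTouches ((cubeFam false L c.a c.M c.ρ c.k) j) y τ →
      W y τ = cfgExp η A' y τ ∧ ‖A' y τ‖ ≤ α₂ * ((L : ℝ) ^ j * η)⁻¹) →
      (∀ (y : Site d) (τ : Fin d), (∀ j, j ≤ c.k → ¬ SideTouches ((cubeFam false L c.a c.M c.ρ c.k) j) y τ) → A' y τ = 0) →
      msup L c.k η (-(1 : ℝ)) (fun j (b : Site d × Fin d) => SideTouches ((cubeFam false L c.a c.M c.ρ c.k) j) b.1 b.2) (fun b => A' b.1 b.2)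
      ≤ inp.B₀ * (bondNorm L c.k η (-(3 : ℝ)) (cubeFam false L c.a c.M c.ρ c.k) (fun x μ => Jcur η U₀ A' μ x)
      + wsup 1 (fun p : {p : ℕ × (Site d × Fin d) // p.1 ≤ c.k ∧ (p.2 ∈ cubeLamB L c.a c.M c.ρ c.k c.k p.1 ∨ (p.1 = 0 ∧ CrossB ((cubeFam false L c.a c.M c.ρ c.k) 0) p.2))} =>
      linCovIter L U₀ (iEta η A') p.1.1 p.1.2.1 p.1.2.2)) + Bbd * msup L c.k η (-(1 : ℝ))
      (fun j (b : Site d × Fin d) => j = 0 ∧ SideTouches ((cubeFam false L c.a c.M c.ρ c.k) 0) b.1 b.2 ∧ ¬ BondTouches ((cubeFam false L c.a c.M c.ρ c.k) 0) b.1 b.2)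
      (fun b => A' b.1 b.2) ∧
      msup L c.k η (-(2 : ℝ)) (fun j (t : Fin d × Fin d × Site d) => SideTouches ((cubeFam false L c.a c.M c.ρ c.k) j) t.2.2 t.2.1)
      (fun t => covDerivFwd η U₀ t.1 (fun z => A' z t.2.1) t.2.2)
      ≤ inp.B₀ * (bondNorm L c.k η (-(3 : ℝ)) (cubeFam false L c.a c.M c.ρ c.k) (fun x μ => Jcur η U₀ A' μ x)
      + wsup 1 (fun p : {p : ℕ × (Site d × Fin d) // p.1 ≤ c.k ∧ (p.2 ∈ cubeLamB L c.a c.M c.ρ c.k c.k p.1 ∨ (p.1 = 0 ∧ CrossB ((cubeFam false L c.a c.M c.ρ c.k) 0) p.2))} =>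
      linCovIter L U₀ (iEta η A') p.1.1 p.1.2.1 p.1.2.2)) + Bbd * msup L c.k η (-(1 : ℝ))
      (fun j (b : Site d × Fin d) => j = 0 ∧ SideTouches ((cubeFam false L c.a c.M c.ρ c.k) 0) b.1 b.2 ∧ ¬ BondTouches ((cubeFam false L c.a c.M c.ρ c.k) 0) b.1 b.2)
      (fun b => A' b.1 b.2) ∧
      bondNorm L c.k η (-(3 : ℝ)) (cubeFam false L c.a c.M c.ρ c.k) (fun x μ => pdiv η U₀ (plaqCovDeriv η U₀ A') μ x)
      ≤ inp.B₀ * (bondNorm L c.k η (-(3 : ℝ)) (cubeFam false L c.a c.M c.ρ c.k) (fun x μ => Jcur η U₀ A' μ x)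
      + wsup 1 (fun p : {p : ℕ × (Site d × Fin d) // p.1 ≤ c.k ∧ (p.2 ∈ cubeLamB L c.a c.M c.ρ c.k c.k p.1 ∨ (p.1 = 0 ∧ CrossB ((cubeFam false L c.a c.M c.ρ c.k) 0) p.2))} =>
      linCovIter L U₀ (iEta η A') p.1.1 p.1.2.1 p.1.2.2)) + Bbd * msup L c.k η (-(1 : ℝ))
      (fun j (b : Site d × Fin d) => j = 0 ∧ SideTouches ((cubeFam false L c.a c.M c.ρ c.k) 0) b.1 b.2 ∧ ¬ BondTouches ((cubeFam false L c.a c.M c.ρ c.k) 0) b.1 b.2)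
      (fun b => A' b.1 b.2) ∧
      bondNorm L c.k η (-(3 : ℝ)) (cubeFam false L c.a c.M c.ρ c.k) (fun x μ => covLap η U₀ (fun z => A' z μ) x)
      ≤ inp.B₀ * (bondNorm L c.k η (-(3 : ℝ)) (cubeFam false L c.a c.M c.ρ c.k) (fun x μ => Jcur η U₀ A' μ x)
      + wsup 1 (fun p : {p : ℕ × (Site d × Fin d) // p.1 ≤ c.k ∧ (p.2 ∈ cubeLamB L c.a c.M c.ρ c.k c.k p.1 ∨ (p.1 = 0 ∧ CrossB ((cubeFam false L c.a c.M c.ρ c.k) 0) p.2))} =>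
      linCovIter L U₀ (iEta η A') p.1.1 p.1.2.1 p.1.2.2)) + Bbd * msup L c.k η (-(1 : ℝ))
      (fun j (b : Site d × Fin d) => j = 0 ∧ SideTouches ((cubeFam false L c.a c.M c.ρ c.k) 0) b.1 b.2 ∧ ¬ BondTouches ((cubeFam false L c.a c.M c.ρ c.k) 0) b.1 b.2)
      (fun b => A' b.1 b.2)) →
      ∀ (U₀ : Site d → Fin d → 𝔸ˣ), (∀ x κ, U₀ x κ ∈ unitaryUnits 𝔸) → ∀ (α₀ : ℝ), 0 < α₀ → InAk L K η α₀ Ω U₀ →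
      7 * d * (L : ℝ) ^ 2 * c.M * α₀ ≤ c₁ →
      GaugedBoundB8 L η U₀ c (7 * d * (L : ℝ) ^ 2 * (5 * (d : ℝ) * L * inp.B₀) * c.M * α₀) := by
  have hL1 : 1 ≤ L := le_trans (by norm_num) hL
  have hd1 : 1 ≤ d := le_trans (by norm_num) hd2
  have hLpos : (0 : ℝ) < L := by exact_mod_cast hL1
  have hdpos : (0 : ℝ) < d := by exact_mod_cast hd1
  have hB₀ : 0 < inp.B₀ := inp.B₀_pos
  obtain ⟨c₄, hc₄, T4⟩ := H4
  obtain ⟨c₃, hc₃, N3⟩ := norms136_cubeMember_at_bdryβ_d4 (𝔸 := 𝔸) hd2 hL hB₀ hC₂ hcB9 hBbd hBd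
  have hC₂0 : 0 ≤ C₂ := le_trans (by positivity) hC₂
  obtain ⟨cW, hcW, W⟩ := windows136_of_small hd2 hL hB₀ hC₂0 hc₃
  set B : ℝ := 5 * (d : ℝ) * L * inp.B₀ with hB_def
  have hB0 : 0 < B := by positivity
  set C : ℝ := 131072 * ((d : ℝ) + 1) ^ 2 with hC_def
  have hC0 : 0 < C := by positivity
  refine ⟨min c₄ (min cW (1 / (16 * C * B))), lt_min hc₄ (lt_min hcW (by positivity)), ?_⟩
  intro η hη K Ω c SB9D U₀ hU₀ α₀ hα hAK hs
  -- the cube's laws as datum binders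
  have hk : 1 ≤ c.k := c.one_le_k
  have hρL : L ≤ c.ρ := c.L_le_ρ
  have hρM : c.ρ ≤ c.M := c.ρ_le_M
  have hρ : 1 ≤ c.ρ := hL1.trans hρL
  have hM1 : 1 ≤ c.M := hρ.trans hρM
  have hM : 11 * (d : ℝ) < c.M := by exact_mod_cast c.big
  have hLdM : (L : ℝ) ≤ d * c.M := by exact_mod_cast c.L_le_dM
  have hA : InAk L c.k η α₀ Ω U₀ := c.inAk hAK
  have hs₄ : 7 * d * (L : ℝ) ^ 2 * c.M * α₀ ≤ c₄ := hs.trans (min_le_left _ _)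
  have hsW : 7 * d * (L : ℝ) ^ 2 * c.M * α₀ ≤ cW := hs.trans ((min_le_right _ _).trans (min_le_left _ _))
  have hsC : 7 * d * (L : ℝ) ^ 2 * c.M * α₀ ≤ 1 / (16 * C * B) := hs.trans ((min_le_right _ _).trans (min_le_right _ _))
  -- every window from «7dL²Mα₀ ≤ c₁»
  obtain ⟨⟨hα3, hα2, hsmall⟩, ⟨hα₀c, hα₁c, hα₂c⟩, h61, ⟨-, -, h16, -, hc3α, hsmall₁⟩, h12⟩ := W c.M c.ρ hM1 hρM hM hLdM α₀ hα hsW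
  -- the shifted smallness pair `(α₀′, α₁′) = (L³α₀, 6dL²Mα₀)` and `t = α₀′ + α₁′`
  have hα₀' : 0 < (L : ℝ) ^ 3 * α₀ := by positivity
  have hMpos : (0 : ℝ) < c.M := by exact_mod_cast hM1
  have hα₁' : 0 < 6 * d * (L : ℝ) ^ 2 * c.M * α₀ := by positivity
  have ht₄ : (L : ℝ) ^ 3 * α₀ + 6 * d * (L : ℝ) ^ 2 * c.M * α₀ ≤ c₄ := smallness_134 hLpos hα hLdM hs₄
  have htpos : 0 < (L : ℝ) ^ 3 * α₀ + 6 * d * (L : ℝ) ^ 2 * c.M * α₀ := add_pos hα₀' hα₁'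
  have hα₂pos : 0 < B * ((L : ℝ) ^ 3 * α₀ + 6 * d * (L : ℝ) ^ 2 * c.M * α₀) := mul_pos hB0 htpos
  -- «the assumptions of Theorem 4 are satisfied for the pair 1, U₀″» (n05-c)
  obtain ⟨hmem, h33, h34, hAx, h135b, h66⟩ :=
    thm4_hypotheses_one_cutFixed L hL hd1 c.k U₀ hU₀ hα hα3 hα2 c.a hρ hρM hM hη hA c.tcube_sub hsmall
  set U'' := cutFixed L (tLo c.a c.ρ) (tHi c.a c.M c.ρ) U₀ c.k (ctr c.a c.M) with hU''
  have hone : ∀ x κ, (1 : Site d → Fin d → 𝔸ˣ) x κ ∈ unitaryUnits 𝔸 := fun _ _ => (unitaryUnits 𝔸).one_mem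
  -- the member `{□_j}` of the cube sub-family
  set ic : ZdIdx d L := ⟨η, hη, c.k, hk, cubeFam false L c.a c.M c.ρ c.k, hΩ_cubeFam hL1 c.a c.M hρL c.k, cubeLamS L c.a c.M c.ρ c.k,
    cubeLamB L c.a c.M c.ρ c.k, hbox_cubeLamB L c.a c.M c.ρ c.k, hclass_cubeLamB L c.a c.M c.ρ c.k, htower_cubeLam hL1 c.a c.M c.ρ c.k,
    hpart_cubeLam hL1 c.a c.M c.ρ c.k⟩ with hic_def
  have hic : ∃ (a : Site d) (M ρ : ℕ), L ≤ ρ ∧ ρ ≤ M ∧ 11 * d < M ∧ L ≤ d * M ∧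
      ic.Ω = cubeFam false L a M ρ ic.k ∧ ic.Λs = cubeLamS L a M ρ ic.k ∧ ic.Λb = cubeLamB L a M ρ ic.k :=
    ⟨c.a, c.M, c.ρ, hρL, hρM, c.big, c.L_le_dM, rfl, rfl, rfl⟩
  -- THEOREM 4 at the member, for the datum `(1, U₀″)` at `(α₀′, α₁′)`
  obtain ⟨u, hR, ⟨h137, hLan, h162⟩, -⟩ :=
    T4 ⟨ic, hic⟩ ((L : ℝ) ^ 3 * α₀) (6 * d * (L : ℝ) ^ 2 * c.M * α₀) hα₀' hα₁' ht₄ ⟨1, hone⟩ (⟨1, hone⟩, ⟨U'', hmem⟩) h33 trivial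
      ⟨rfl, h34, hAx⟩ ⟨h135b, h66⟩
  have hu : ∀ x, u.1 x ∈ unitaryUnits 𝔸 := u.2.1
  have huS : ∀ x, x ∉ cubeFam false L c.a c.M c.ρ c.k 0 → u.1 x = 1 := u.2.2
  have h129 : Restr129 L c.k (cubeLamS L c.a c.M c.ρ c.k c.k) (1 : Site d → Fin d → 𝔸ˣ) u.1 := hR
  -- the gauge-fixed field `U₁ = U₀″^{u⁻¹}` (at background `1` the moving-frame action is the ordinary gauge action)
  have hW : mgauge (1 : Site d → Fin d → 𝔸ˣ) u.1 (mgauge (1 : Site d → Fin d → 𝔸ˣ) u.1⁻¹ U'') = U'' := mgauge_mgauge_inv _ U'' u.1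
  have hWu : ∀ x κ, mgauge (1 : Site d → Fin d → 𝔸ˣ) u.1⁻¹ U'' x κ ∈ unitaryUnits 𝔸 := mem_unitaryUnits_of_mgauge_eq hone hmem hu hW
  have hLan' : IsLandau138W L c.k η (cubeFam false L c.a c.M c.ρ c.k 0) (cubeLamS L c.a c.M c.ρ c.k c.k) (1 : Site d → Fin d → 𝔸ˣ)
      (gaugeAct u.1⁻¹ U'') := by
    have h := hLan
    simp only [zdGF3, mgauge_one_left] at h
    exact h
  have h162' : ∀ j, j ≤ c.k → ∀ b ∈ {b : Site d × Fin d | SideTouches (cubeFam false L c.a c.M c.ρ c.k j) b.1 b.2},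
      gaugeAct u.1⁻¹ U'' b.1 b.2 = cfgExp η (logCfg η (gaugeAct u.1⁻¹ U'')) b.1 b.2 ∧
        IsSelfAdjoint (logCfg η (gaugeAct u.1⁻¹ U'') b.1 b.2) ∧
        ‖logCfg η (gaugeAct u.1⁻¹ U'') b.1 b.2‖ ≤
          (5 * (d : ℝ) * L * inp.B₀ * ((L : ℝ) ^ 3 * α₀ + 6 * d * (L : ℝ) ^ 2 * c.M * α₀)) * ((L : ℝ) ^ j * η)⁻¹ := by
    have h := h162
    simp only [zdGF3, mgauge_one_left] at h
    exact h
  -- PROPOSITION 3's norm members at the member FROM THE β SOCKET AT THE CUBE (this seat's `norms136_cubeMember_at_bdryβ_d4`)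
  obtain ⟨h136g, h139j, h139l⟩ := N3 η hη c.k hk c.a c.M c.ρ hρL hρM hM SB9D U₀ hU₀ α₀ hα hα3 hα2 Ω hA c.tcube_sub hsmall hα₀c hα₂c
    h61 hsmall₁ u.1 hu huS h129 hLan' h162'
  -- the three norm members of (1.136), with print's constant (`const_136`)
  have hconst : B * ((L : ℝ) ^ 3 * α₀ + 6 * d * (L : ℝ) ^ 2 * c.M * α₀) ≤ 7 * d * (L : ℝ) ^ 2 * B * c.M * α₀ :=
    const_136 hLpos hα hB0.le hLdM
  have h136₂ : B8ScaledSupNorm.msup L c.k η (-(2 : ℝ)) (fun j (t : Fin d × Fin d × Site d) => SideTouches (cubeFam false L c.a c.M c.ρ c.k j) t.2.2 t.2.1)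
      (fun t => B8Ineq132.covDerivFwd η (1 : Site d → Fin d → 𝔸ˣ) t.1
        (fun z => mlogCfg c.k η (cubeFam false L c.a c.M c.ρ c.k) (gaugeAct u.1⁻¹ U'') z t.2.1) t.2.2) ≤
      7 * d * (L : ℝ) ^ 2 * (5 * (d : ℝ) * L * inp.B₀) * c.M * α₀ := by
    exact h136g.trans hconst
  have h136₃ : B8ScaledSupNorm.bondNorm L c.k η (-(3 : ℝ)) (cubeFam false L c.a c.M c.ρ c.k)
      (fun x μ => B8Eq143PlaqExpansion.pdiv η (1 : Site d → Fin d → 𝔸ˣ) (B8Eq146AExpansion.plaqCovDeriv η (1 : Site d → Fin d → 𝔸ˣ)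
        (mlogCfg c.k η (cubeFam false L c.a c.M c.ρ c.k) (gaugeAct u.1⁻¹ U''))) μ x) ≤
      7 * d * (L : ℝ) ^ 2 * (5 * (d : ℝ) * L * inp.B₀) * c.M * α₀ := by
    exact h139j.trans hconst
  have h136₄ : B8ScaledSupNorm.bondNorm L c.k η (-(3 : ℝ)) (cubeFam false L c.a c.M c.ρ c.k)
      (fun x μ => B8Eq138LandauZd.covLap η (1 : Site d → Fin d → 𝔸ˣ)
        (fun z => mlogCfg c.k η (cubeFam false L c.a c.M c.ρ c.k) (gaugeAct u.1⁻¹ U'') z μ) x) ≤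
      7 * d * (L : ℝ) ^ 2 * (5 * (d : ℝ) * L * inp.B₀) * c.M * α₀ := by
    exact h139l.trans hconst
  -- (1.135): `w = v⁻¹u` is unitary and `U₀^{w⁻¹} = U₁` on `□̃`
  have hΩ' : ∃ l, l ≤ c.k ∧ c.k ≤ l + 1 ∧ ∀ x, InBox (B8Ineq130.tlo L (tLo c.a c.ρ) c.k) (B8Ineq130.thi L (tHi c.a c.M c.ρ) c.k) x → x ∈ Ω l :=
    ⟨c.k - 1, Nat.sub_le _ _, by omega, fun x hx => c.tcube_sub hx⟩
  have hvG : ∀ x, localGauge L (tLo c.a c.ρ) (tHi c.a c.M c.ρ) U₀ c.k (ctr c.a c.M) x ∈ unitaryUnits 𝔸 :=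
    localGauge_mem L hL (avgClosed_unitaryUnits (𝔸 := 𝔸) d L) c.k U₀ hU₀ hα hα3 hα2 (tLo_le_tHi hM1)
      (pdevOn_lt_of_inAk hL1 hα hA hΩ') (ctr c.a c.M)
  have hw : ∀ x, ((localGauge L (tLo c.a c.ρ) (tHi c.a c.M c.ρ) U₀ c.k (ctr c.a c.M))⁻¹ * u.1) x ∈ unitaryUnits 𝔸 := fun x =>
    (unitaryUnits 𝔸).mul_mem ((unitaryUnits 𝔸).inv_mem (hvG x)) (hu x)
  have h135 := agree135 (B8Ineq130.tlo L (tLo c.a c.ρ) c.k) (B8Ineq130.thi L (tHi c.a c.M c.ρ) c.k) U₀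
    (localGauge L (tLo c.a c.ρ) (tHi c.a c.M c.ρ) U₀ c.k (ctr c.a c.M)) u.1
  -- the [3]-Prop.-4 window of the engine
  have h16C : 16 * (131072 * ((d : ℝ) + 1) ^ 2) * (B * ((L : ℝ) ^ 3 * α₀ + 6 * d * (L : ℝ) ^ 2 * c.M * α₀)) ≤ 1 := by
    have e2 : 7 * d * (L : ℝ) ^ 2 * B * c.M * α₀ = B * (7 * d * (L : ℝ) ^ 2 * c.M * α₀) := by ring
    have e3 : B * (7 * d * (L : ℝ) ^ 2 * c.M * α₀) ≤ B * (1 / (16 * C * B)) := mul_le_mul_of_nonneg_left hsC hB0.le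
    have e4 : B * (1 / (16 * C * B)) = 1 / (16 * C) := by field_simp
    have e5 : B * ((L : ℝ) ^ 3 * α₀ + 6 * d * (L : ℝ) ^ 2 * c.M * α₀) ≤ 1 / (16 * C) := by linarith [hconst, e3]
    calc 16 * (131072 * ((d : ℝ) + 1) ^ 2) * (B * ((L : ℝ) ^ 3 * α₀ + 6 * d * (L : ℝ) ^ 2 * c.M * α₀))
        ≤ 16 * C * (1 / (16 * C)) := mul_le_mul_of_nonneg_left e5 (by positivity)
      _ = 1 := by field_simp
  exact gaugedBoundB8_of_clauses hd2 hL hB₀ hη c U₀ hU₀ hα hA hα3 hα2 hsmall h12 h16C hc3α u.1 hu huS h129 hLan' h162' hw h135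
    h136₂ h136₃ h136₄



#print axioms gaugedBoundB8_cubeMember_of_thm4_b9Dβ_d4

/-- ★ **`B8.Prop6Printed d L (5dL·inp.B₀) c₁` ON `Node00.zdCub`, FROM THEOREM 4 AS PRINTED ON THE CUBE SUB-FAMILY AND THE FOUR-LINE β SOCKET AT EVERY
CUBE** (`gaugedBoundB8_cubeMember_of_thm4_b9Dβ_d4` through `Node00.prop6Printed_zdCub_iff`); the per-cube binder is the body of `SockB9P3D4β … c.k (cubeFam false L
c.a c.M c.ρ c.k) (cubeLamS …) (cubeLamB …)` at background-pair data, so a `SockB9P3D4β` family on the cubes feeds it by `exact`.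
[cite: Balaban1985RegularSpaces, Prop. 6 p.99, Thm 4 p.88, Prop. 3 p.87, (1.59) p.86, (1.31) p.82] -/
theorem prop6Printed_zdCub_of_thm4_b9Dβ_d4 (hd2 : 2 ≤ d) {L : ℕ} (hL : 2 ≤ L) (inp : B8.B9Inputs) {C₂ cB9 Bbd : ℝ}
    (hC₂ : 2097152 * ((d : ℝ) + 1) ^ 2 ≤ C₂) (hcB9 : 0 < cB9) (hBbd : 0 ≤ Bbd) (hBd : 4 * Bbd ≤ ((d : ℝ) * L - 1) * inp.B₀)
    (β : ℝ) (len : Site d → ℝ)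
    (H4 : B8.Thm4Printed (5 * (d : ℝ) * L * inp.B₀)
      (fun i : {i : ZdIdx d L // ∃ (a : Site d) (M ρ : ℕ), L ≤ ρ ∧ ρ ≤ M ∧ 11 * d < M ∧ L ≤ d * M ∧
        i.Ω = cubeFam false L a M ρ i.k ∧ i.Λs = cubeLamS L a M ρ i.k ∧ i.Λb = cubeLamB L a M ρ i.k} => (zdGF3 𝔸 L β len i.1).toGFData)) :
    ∃ c₁ : ℝ, 0 < c₁ ∧ ∀ {ι : Type} (f : ι → ZdIdx d L),
      (∀ (jf : ι) (c : CubeB8 d L (f jf).k (f jf).Ω),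
      (∀ α₀ α₂ : ℝ, 0 < α₀ → α₀ ≤ cB9 → 0 < α₂ → α₂ ≤ cB9 →
      ∀ (U₀ W : Site d → Fin d → 𝔸ˣ), (∀ x κ, U₀ x κ ∈ unitaryUnits 𝔸) → (∀ x κ, W x κ ∈ unitaryUnits 𝔸) →
      InAk L c.k (f jf).η α₀ (cubeFam false L c.a c.M c.ρ c.k) U₀ → InAk L c.k (f jf).η α₀ (cubeFam false L c.a c.M c.ρ c.k) (mulCfg W U₀) → IsLandau138W L c.k (f jf).η ((cubeFam false L c.a c.M c.ρ c.k) 0) (cubeLamS L c.a c.M c.ρ c.k c.k) U₀ W →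
      ∀ A' : Site d → Fin d → 𝔸, (∀ y τ, IsSelfAdjoint (A' y τ)) →
      (∀ j, j ≤ c.k → ∀ (y : Site d) (τ : Fin d), SideTouches ((cubeFam false L c.a c.M c.ρ c.k) j) y τ →
      W y τ = cfgExp (f jf).η A' y τ ∧ ‖A' y τ‖ ≤ α₂ * ((L : ℝ) ^ j * (f jf).η)⁻¹) →
      (∀ (y : Site d) (τ : Fin d), (∀ j, j ≤ c.k → ¬ SideTouches ((cubeFam false L c.a c.M c.ρ c.k) j) y τ) → A' y τ = 0) →
      msup L c.k (f jf).η (-(1 : ℝ)) (fun j (b : Site d × Fin d) => SideTouches ((cubeFam false L c.a c.M c.ρ c.k) j) b.1 b.2) (fun b => A' b.1 b.2)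
      ≤ inp.B₀ * (bondNorm L c.k (f jf).η (-(3 : ℝ)) (cubeFam false L c.a c.M c.ρ c.k) (fun x μ => Jcur (f jf).η U₀ A' μ x)
      + wsup 1 (fun p : {p : ℕ × (Site d × Fin d) // p.1 ≤ c.k ∧ (p.2 ∈ cubeLamB L c.a c.M c.ρ c.k c.k p.1 ∨ (p.1 = 0 ∧ CrossB ((cubeFam false L c.a c.M c.ρ c.k) 0) p.2))} =>
      linCovIter L U₀ (iEta (f jf).η A') p.1.1 p.1.2.1 p.1.2.2)) + Bbd * msup L c.k (f jf).η (-(1 : ℝ))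
      (fun j (b : Site d × Fin d) => j = 0 ∧ SideTouches ((cubeFam false L c.a c.M c.ρ c.k) 0) b.1 b.2 ∧ ¬ BondTouches ((cubeFam false L c.a c.M c.ρ c.k) 0) b.1 b.2)
      (fun b => A' b.1 b.2) ∧
      msup L c.k (f jf).η (-(2 : ℝ)) (fun j (t : Fin d × Fin d × Site d) => SideTouches ((cubeFam false L c.a c.M c.ρ c.k) j) t.2.2 t.2.1)
      (fun t => covDerivFwd (f jf).η U₀ t.1 (fun z => A' z t.2.1) t.2.2)
      ≤ inp.B₀ * (bondNorm L c.k (f jf).η (-(3 : ℝ)) (cubeFam false L c.a c.M c.ρ c.k) (fun x μ => Jcur (f jf).η U₀ A' μ x)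
      + wsup 1 (fun p : {p : ℕ × (Site d × Fin d) // p.1 ≤ c.k ∧ (p.2 ∈ cubeLamB L c.a c.M c.ρ c.k c.k p.1 ∨ (p.1 = 0 ∧ CrossB ((cubeFam false L c.a c.M c.ρ c.k) 0) p.2))} =>
      linCovIter L U₀ (iEta (f jf).η A') p.1.1 p.1.2.1 p.1.2.2)) + Bbd * msup L c.k (f jf).η (-(1 : ℝ))
      (fun j (b : Site d × Fin d) => j = 0 ∧ SideTouches ((cubeFam false L c.a c.M c.ρ c.k) 0) b.1 b.2 ∧ ¬ BondTouches ((cubeFam false L c.a c.M c.ρ c.k) 0) b.1 b.2)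
      (fun b => A' b.1 b.2) ∧
      bondNorm L c.k (f jf).η (-(3 : ℝ)) (cubeFam false L c.a c.M c.ρ c.k) (fun x μ => pdiv (f jf).η U₀ (plaqCovDeriv (f jf).η U₀ A') μ x)
      ≤ inp.B₀ * (bondNorm L c.k (f jf).η (-(3 : ℝ)) (cubeFam false L c.a c.M c.ρ c.k) (fun x μ => Jcur (f jf).η U₀ A' μ x)
      + wsup 1 (fun p : {p : ℕ × (Site d × Fin d) // p.1 ≤ c.k ∧ (p.2 ∈ cubeLamB L c.a c.M c.ρ c.k c.k p.1 ∨ (p.1 = 0 ∧ CrossB ((cubeFam false L c.a c.M c.ρ c.k) 0) p.2))} =>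
      linCovIter L U₀ (iEta (f jf).η A') p.1.1 p.1.2.1 p.1.2.2)) + Bbd * msup L c.k (f jf).η (-(1 : ℝ))
      (fun j (b : Site d × Fin d) => j = 0 ∧ SideTouches ((cubeFam false L c.a c.M c.ρ c.k) 0) b.1 b.2 ∧ ¬ BondTouches ((cubeFam false L c.a c.M c.ρ c.k) 0) b.1 b.2)
      (fun b => A' b.1 b.2) ∧
      bondNorm L c.k (f jf).η (-(3 : ℝ)) (cubeFam false L c.a c.M c.ρ c.k) (fun x μ => covLap (f jf).η U₀ (fun z => A' z μ) x)
      ≤ inp.B₀ * (bondNorm L c.k (f jf).η (-(3 : ℝ)) (cubeFam false L c.a c.M c.ρ c.k) (fun x μ => Jcur (f jf).η U₀ A' μ x)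
      + wsup 1 (fun p : {p : ℕ × (Site d × Fin d) // p.1 ≤ c.k ∧ (p.2 ∈ cubeLamB L c.a c.M c.ρ c.k c.k p.1 ∨ (p.1 = 0 ∧ CrossB ((cubeFam false L c.a c.M c.ρ c.k) 0) p.2))} =>
      linCovIter L U₀ (iEta (f jf).η A') p.1.1 p.1.2.1 p.1.2.2)) + Bbd * msup L c.k (f jf).η (-(1 : ℝ))
      (fun j (b : Site d × Fin d) => j = 0 ∧ SideTouches ((cubeFam false L c.a c.M c.ρ c.k) 0) b.1 b.2 ∧ ¬ BondTouches ((cubeFam false L c.a c.M c.ρ c.k) 0) b.1 b.2)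
      (fun b => A' b.1 b.2))) →
      B8.Prop6Printed d (L : ℝ) (5 * (d : ℝ) * L * inp.B₀) c₁ (fun j => zdCub 𝔸 L (f j)) := by
  obtain ⟨c₁, hc₁, G⟩ := gaugedBoundB8_cubeMember_of_thm4_b9Dβ_d4 (𝔸 := 𝔸) hd2 hL inp hC₂ hcB9 hBbd hBd β len H4
  refine ⟨c₁, hc₁, fun f S => ?_⟩
  rw [prop6Printed_zdCub_iff]
  intro j α₀ hα U₀ hInA c hs
  exact G (f j).η (f j).hη c (S j c) U₀.1 U₀.2 α₀ hα hInA hs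

#print axioms prop6Printed_zdCub_of_thm4_b9Dβ_d4

end Literature.MathematicalPhysics.QuantumFieldTheory.Balaban1983to89.B8Prop6CubeMemberGaugedBdryBeta

end

/-! ## HONEST SCOPE — VACUOUS AS TYPED (2026-08-27, seat `pub-ymgap-dag-n05-e` g9; director-ym LINE №196, dag-lead DEDUP-349∕350)

Every theorem of this file whose hypotheses contain a (1.59)-type clause or socket in EDITION β at a CUBE MEMBER of (1.131) — the SCALAR clauses
SC2∕SC4, the 𝔸-valued sockets `SockB9P3D4β` ∕ `H59Dβ` ∕ the four-line Prop.-3-frame socket, or a hypothesis SET that yields them (`B9.Thm33Printed` +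
dag-n06-b's member-local binders at every truncation) — is VACUOUS AS TYPED: the averaging datum is read over `B8CubeMemberZd.cubeLamB`, whose condition 1
«fine box ⊂ □_j» EMPTIES print's crossing bonds of (1.31) at levels `j ≥ 1`, and the interior SHELL GAUGE MODES `∂(𝟙λ)`, `λ ⊂ □_j`, then defeat the clause at
every cube member with `k ≥ 1` for ALL constants `B₀, B_∂` — KERNEL CERTIFICATE dag-n05-c `B8Ineq159FlatShellModeVacuity` (p572834:
`not_flat159β_two_cubeMember(_one)`, `sc2_uninhabited_cubeB8`; ref-E g12 READ-11 A6-FINAL), `Ω₀ = ℤᵈ` twin `…ShellModeVacuityUniv` (p576185).  The theorems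
stay TRUE and PASS-AS-DECLARED; their content at cube members is nil.  Nothing of [Balaban1985RegularSpaces] is refuted: print's class ([B6] (2.3), «at least
one end-point in Ω_j^{(j)}») contains the crossing bonds and kills the modes (dag-n05-c `B8Ineq159FlatShellModeCrossingDatum`).  SUPERSEDED BY EDITION γ: the
datum class of record becomes dag-n05-c's `B8Ineq159FlatCubeMemberPrinted.cubeLamBP` (p573921∕p575549), the socket dag-n06-b's `B9SupplySockB9P3ZdGamma`, the
Theorem-4 driver this seat's `B8Eq142KLevelLocalGamma` ∕ `B8Thm4KLevelGamma`; this file is kept as history and for its class-independent mechanics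
(composition shape, ⊗-id transfer, the level-0 crossing MOVE), re-run by token swap in γ.  Count-neutral; N05 NOT discharged; nothing continuum ∕ ℝ⁴ ∕ OS ∕
mass-gap ∕ Clay. -/
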